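import Summits.QuantumFields.YangMills.Theorems.FluctuationComparisonRegPrIntLS2BetaQuaternionReadRemainderDictionary
import Literature.MathematicalPhysics.QuantumFieldTheory.Balaban1983to89.T3OneStepAveragingPlaquettes
import HarnessLib

/-!
# S2β · Q9a — THE GAP-ONE DICTIONARY: the one-step quaternion read `Mq_{i←i+1}(V)` and its derivative `DMq^{one}(V)` in the currency of the ONE-STEP chart read `ψ_V` of (β)

Cell `ym3-torus` (rung R3 = continuum `SU(2)` YM₃ on T³ at fixed lattice data — NOT d = 4, NOT infinite volume, NOT a mass gap, NOT Clay).  Width seat `ym3-torus-px5` (gen 23);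
crux `stmt-QuantumFields-20520`, LINE g18-1 S2β, AVG₂♭-ax_q road (UV3-NODE §89.7): Q7 ✓p827759 writes the letter's vector as the telescope of ONE-STEP brackets
`η⁽ᵗ⁾ − DMq_{J+t←J+t+1}(D_{J+t+1,K}U₀) η⁽ᵗ⁺¹⁾`; Q8 ✓p828063 splits `Mq ζ̃ − DMq(sinc∘ζ̃•ζ̃)` at a general gap `(J,K)` into `Ψ_{K−J}(X) − DΨ_{K−J}(0)X` plus two cubes, with
`Ψ_{K−J}` the log-chart ITERATE; the (β) bricks of px13 g26 ((β-1) ✓p827817, (β-2)(β-3)(β-4)) bound the ONE-STEP chart read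
`ψ_V(A)(c) = Λ(Ū(Θ^B(A)·V)(c)·Ū(V)(c)⁻¹)` (lit `avgFun`, generic `P`).  At gap one the T³ descent is `fieldShift (j′ := 1) ∘ Ū` (lit ✓`descendTo_succ`), while Q8's
`Ψ_{i+1−i}` sits on `PBond _ (i+1−i)` — propositionally, not syntactically, level `1`.  THIS FILE is the gap-one dictionary in `ψ_V`'s own currency, so that (β-3) docks by `exact`;
`--kind proof --supports stmt-QuantumFields-20520 --as helper`, count-neutral, DEFINITION-FREE (0 `def`, 0 `instance`, 0 `notation`, 0 `sorry`, default heartbeats).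

NOTATION (written out in every statement).  `V : GaugeField (F.P (i+1)) 0 SU(2)` the base; `σ₁ b := bondShift (F.sitesPerDir_eq (K := i) (j := 0) (K′ := i+1) (j′ := 1) _) b`;
`ψ_V A c := Λ(avgFun ℰ (Θ^B(A)·V) c·(avgFun ℰ V c)⁻¹)` (`ℰ = expMeanLogSU (n := Fin 2)`, `c : PBond (F.P (i+1)) (0+1)`); `coord x := ⟨su2Coord (rev x), _⟩`;
`Mq^{one}(V) ζ b := imVec (su2Quat (D_{i,i+1}(expPoint ζ•V) b·D_{i,i+1}V b⁻¹))`, `DMq^{one}(V) := fderiv ℝ (Mq^{one}(V)) 0`.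

WHAT IS PROVED (sorry-free).
* §0 `iter_eq_fieldShift_iter` (the `subst` reindexing: `Ū^a = fieldShift _ ∘ Ū^b` along `a = b`), `descendTo_succ_apply` (**`D_{i,i+1}X b = avgFun ℰ X (σ₁ b)`**),
  `iter_sub_self_succ_apply` (**`Ū^{i+1−i} X c = avgFun ℰ X (bondShift _ c)`**), `chartRead_iter_sub_self_succ_eq` (**`Ψ_{i+1−i} = (reindex) ∘ ψ_V`** as functions).
* §1 ★★`coord_qRead_one_apply` — on the window at `b` (`‖↑(avgFun(expPoint ζ•V)(σ₁b)·(avgFun V (σ₁b))⁻¹) − 1‖ < innerRadius`): **`coord (Mq^{one}(V) ζ b) = sinc‖y₁‖ • y₁`**,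
  `y₁ := ψ_V(coord∘ζ)(σ₁ b)` (Q8 ✓`coord_qRead_apply` at `(i,i+1)` + §0).
* §2 ★★`coord_qfderiv_one_apply` — under Q1's guard at `(i,i+1)` (`V ∈ histGood θ (i+1) i`, `(5L)²∕4·θ(i+1) ≤ α ≤ 1∕24`, `α < δ_{SU(2)}`, `157α < L⁻²`):
  **`coord ((DMq^{one}(V) η) b) = (fderiv ℝ ψ_V 0 (coord∘η)) (σ₁ b)`** (Q3 ✓`coord_qfderiv_apply` + §0 + the chain rule through the linear reindexing, N09 ✓`contDiffAt_chartRead_avgFun`).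
* §3 ★★★`coord_qRead_one_sub_qfderiv_sinc_eq` — the EXACT gap-one split **`coord (Mq^{one} ζ̃ b − DMq^{one}(sinc∘ζ̃•ζ̃) b) = (y₁ − Dψ_V(0) X (σ₁b)) + ((sinc‖y₁‖ − 1)•y₁ − Dψ_V(0)
  ((sinc∘ζ̃ − 1)•X)(σ₁b))`**, `X := coord∘ζ̃`; ★★★`norm_qRead_one_sub_qfderiv_sinc_le` — **`‖Mq^{one} ζ̃ b − DMq^{one}(sinc∘ζ̃•ζ̃) b‖ ≤ ‖↑y₁ − ↑(Dψ_V(0) X (σ₁b))‖ + ‖y₁‖³∕6 +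
  ‖Dψ_V(0)((sinc∘ζ̃ − 1)•X)(σ₁b)‖`** with the FIRST term in (β-3)'s matrix-coercion currency (✓`norm_chartRead_sub_fderiv_le_SU2`∕`_local` dock by `exact`).

HONEST SCOPE.  Reindexing ∕ chain-rule bookkeeping over Q3, Q8, lit ✓`descendTo_succ` and N09; nothing of Bałaban's analysis is asserted or proved ([Balaban1985Averaging] (123) is (β-3));
AVG₂♭-ax_q, TAYLOR♭_q, «MULT♭-ax», «CRIT-ax», (D-ax)∕(F-ax), GAP♯∘ (`stub_uniformFibreGapOrbit`, registry 3732b7df UNTOUCHED), S2β, the five registered stubs, 20520, 19936, 19200,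
`YM3TorusSU2` NOT proved; no summit statement is proved by a helper; rung R3 — NOT d = 4, NOT infinite volume, NOT a mass gap, NOT Clay; the Yang–Mills mass gap is NOT proved.

References: T. Bałaban, CMP **98** (1985) 17–51 [Balaban1985Averaging] (Prop. 3 (121)–(124) p.36); CMP **109** (1987) 249–301 [Balaban1987RG1] ((0.1) p.251, (0.4), (0.11) p.253);
CMP **102** (1985) 255–275 [Balaban1985UV3] ((7) p.257, p.260).
-/

set_option autoImplicit false

noncomputable section

open scoped Matrix.Norms.L2Operator Topology RealInnerProductSpace Quaternion
open Filter Set Function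
open Literature.MathematicalPhysics.QuantumLattice (su2Quat fundamentalRep fundamentalRep_apply)
open Literature.MathematicalPhysics.QuantumFieldTheory.Balaban1983to89
open Literature.MathematicalPhysics.QuantumFieldTheory.Balaban1983to89.HaarExponentialChart
open Literature.MathematicalPhysics.QuantumFieldTheory.Balaban1983to89.HaarExponentialChart.IsChartRep
open Literature.MathematicalPhysics.QuantumFieldTheory.Balaban1983to89.BlockAveraging (Small Idx avgFun loopHol blockAvg blockAvg_avg)
open Literature.MathematicalPhysics.QuantumFieldTheory.Balaban1983to89.ExpMeanLog (expMeanLogSU deltaSU deltaSU_pos)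
open Literature.MathematicalPhysics.QuantumFieldTheory.Balaban1983to89.Node00
open Literature.MathematicalPhysics.QuantumFieldTheory.Balaban1983to89.T3ContinuumYM3Torus
open Literature.MathematicalPhysics.QuantumFieldTheory.Balaban1983to89.T3UnitLawDensityEML (ℰp)
open Literature.MathematicalPhysics.QuantumFieldTheory.Balaban1983to89.T3UnitScaleTilt
open Literature.MathematicalPhysics.QuantumFieldTheory.Balaban1983to89.T3TiltDescent
open Literature.MathematicalPhysics.QuantumFieldTheory.Balaban1983to89.T3LevelShift (fieldShift bondShift fieldShift_apply fieldShift_refl bondShift_bondShift)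
open Literature.MathematicalPhysics.QuantumFieldTheory.Balaban1983to89.T3OneStepAveragingPlaquettes (descendTo_succ)
open Literature.MathematicalPhysics.QuantumFieldTheory.Balaban1983to89.T4HaarSU2ExpChart (expPoint expPoint_zero imQuat su2Quat_expPoint)
open Literature.MathematicalPhysics.QuantumFieldTheory.Balaban1983to89.T4ExpWindowSmallField (imVec logVec)
open Literature.MathematicalPhysics.QuantumFieldTheory.Balaban1983to89.B10Eq18SigmaSU2 (su2Coord)
open Literature.MathematicalPhysics.QuantumFieldTheory.Balaban1983to89.B10Eq18SigmaSU2Haar (rev)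
open Literature.MathematicalPhysics.QuantumFieldTheory.Balaban1983to89.T4Continuum
open Summit.QuantumFields.YangMills.BalabanUVNodes.N09ChartReadAveragingSmooth (contDiffAt_chartRead_avgFun)
open Summit.QuantumFields.YangMills.Theorems.FluctuationComparisonRegPrIntLS2BetaChartReadDescentOntoExpPoint
  (su2Coord_rev_mem_lie expPoint_eq_expChart piExpPoint_translate_eq exists_coordEquiv)
open Summit.QuantumFields.YangMills.Theorems.FluctuationComparisonRegPrIntLS2BetaChartReadDescentOntoT3 (loopGuard_of_histGood)
open Summit.QuantumFields.YangMills.Theorems.FluctuationComparisonRegPrIntLS2BetaChartReadDescentDerivKStepSupT3 (norm_coord_eq)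
open Summit.QuantumFields.YangMills.Theorems.FluctuationComparisonRegPrIntLS2BetaQuaternionReadDictionary (coord_qfderiv_apply)
open Summit.QuantumFields.YangMills.Theorems.FluctuationComparisonRegPrIntLS2BetaQuaternionReadFibreIdentity (imVec_su2Quat_expPoint norm_sinc_smul_sub_self_le)
open Summit.QuantumFields.YangMills.Theorems.FluctuationComparisonRegPrIntLS2BetaQuaternionReadRemainderDictionary (coord_smul coord_sub coord_qRead_apply)

namespace Summit.QuantumFields.YangMills.Theorems.FluctuationComparisonRegPrIntLS2BetaQuaternionReadOneStepDictionary

variable {F : T3Family}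

/-! ## §0 Reindexing: one descent step is one averaging read through `bondShift (j′ := 1)`; `Ū^{i+1−i}` is `Ū` read through a trivial reindexing -/

section Reindex

/-- The `subst` reindexing: along a propositional equality of step counts `a = b`, `Ū^a X = fieldShift _ (Ū^b X)`. [cite: Balaban1987RG1, (0.1) p.251, (0.11) p.253 (bookkeeping)] -/
theorem iter_eq_fieldShift_iter {G : Type*} [GaugeGroup G] (ℰ : LoopAverage G) {K a b : ℕ} (hab : a = b) (X : GaugeField (F.P K) 0 G) :
    Averaging.iter (fun j => blockAvg (P := F.P K) (j := j) ℰ) a X =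
      fieldShift (F.sitesPerDir_eq (m := F.m) (K := K) (j := a) (m' := F.m) (K' := K) (j' := b) (by omega))
        (Averaging.iter (fun j => blockAvg (P := F.P K) (j := j) ℰ) b X) := by
  subst hab
  exact (fieldShift_refl _ _).symm

/-- **ONE DESCENT STEP, BONDWISE**: `D_{i,i+1}X b = avgFun ℰp X (σ₁ b)` (lit ✓`descendTo_succ`, ✓`blockAvg_avg`). [cite: Balaban1987RG1, (0.11) p.253] -/
theorem descendTo_succ_apply {G : Type*} [GaugeGroup G] (ℰ : LoopAverage G) (i : ℕ) (X : GaugeField (F.P (i + 1)) 0 G) (b : PBond (F.P i) 0) :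
    descendTo F ℰ i (i + 1) (Nat.le_succ i) X b =
      avgFun ℰ X (bondShift (F.sitesPerDir_eq (m := F.m) (K := i) (j := 0) (m' := F.m) (K' := i + 1) (j' := 1) (by omega)) b) := by
  rw [descendTo_succ, fieldShift_apply, blockAvg_avg]
  rfl

/-- **`Ū^{i+1−i}` IS ONE AVERAGING, BONDWISE**: `Ū^{i+1−i} X c = avgFun ℰ X (bondShift _ c)` for `c : PBond (F.P (i+1)) (i+1−i)`. [cite: Balaban1987RG1, (0.11) p.253 (bookkeeping)] -/
theorem iter_sub_self_succ_apply {G : Type*} [GaugeGroup G] (ℰ : LoopAverage G) (i : ℕ) (X : GaugeField (F.P (i + 1)) 0 G) (c : PBond (F.P (i + 1)) (i + 1 - i)) :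
    Averaging.iter (fun j => blockAvg (P := F.P (i + 1)) (j := j) ℰ) (i + 1 - i) X c =
      avgFun ℰ X (bondShift (F.sitesPerDir_eq (m := F.m) (K := i + 1) (j := i + 1 - i) (m' := F.m) (K' := i + 1) (j' := 1) (by omega)) c) := by
  have h := iter_eq_fieldShift_iter (F := F) ℰ (K := i + 1) (show i + 1 - i = 1 by omega) X
  have hc := congrFun h c
  rw [hc, fieldShift_apply]
  rfl

end Reindex

/-! ## §1 The value dictionary at gap one -/

section Value

/-- **THE ONE-STEP QUATERNION READ IN `avgFun` FORM**: `Mq^{one}(V) ζ b = imVec (su2Quat (avgFun(expPoint ζ•V)(σ₁ b)·(avgFun V (σ₁ b))⁻¹))`.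
[cite: Balaban1987RG1, (0.4), (0.11) p.253 (bookkeeping)] -/
theorem qRead_one_apply (i : ℕ) (V : GaugeField (F.P (i + 1)) 0 (SU 2)) (ζ : PBond (F.P (i + 1)) 0 → EuclideanSpace ℝ (Fin 3)) (b : PBond (F.P i) 0) :
    imVec (su2Quat (descendTo F ℰp i (i + 1) (Nat.le_succ i) (fun ℓ => expPoint (ζ ℓ) * V ℓ) b * (descendTo F ℰp i (i + 1) (Nat.le_succ i) V b)⁻¹)) =
      imVec (su2Quat (avgFun (expMeanLogSU (n := Fin 2)) (fun ℓ => expPoint (ζ ℓ) * V ℓ : GaugeField (F.P (i + 1)) 0 (SU 2))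
          (bondShift (F.sitesPerDir_eq (m := F.m) (K := i) (j := 0) (m' := F.m) (K' := i + 1) (j' := 1) (by omega)) b) *
        (avgFun (expMeanLogSU (n := Fin 2)) V
          (bondShift (F.sitesPerDir_eq (m := F.m) (K := i) (j := 0) (m' := F.m) (K' := i + 1) (j' := 1) (by omega)) b))⁻¹)) := by
  rw [descendTo_succ_apply, descendTo_succ_apply]

/-- **THE ONE-STEP CHART READ AT `coord∘ζ`, READ AT `σ₁ b`, IS THE LOG CHART OF THE RELATIVE COARSE FIELD** (`Θ ∘ coord = expPoint`).
[cite: Balaban1985UV3, p. 260; Balaban1987RG1, (0.4) p.253 (bookkeeping)] -/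
theorem chartRead_avgFun_coord_apply (i : ℕ) (V : GaugeField (F.P (i + 1)) 0 (SU 2)) (ζ : PBond (F.P (i + 1)) 0 → EuclideanSpace ℝ (Fin 3))
    (c : PBond (F.P (i + 1)) (0 + 1)) :
    (fun (A : PBond (F.P (i + 1)) 0 → (specialUnitaryLogChart (Fin 2)).lie) (c : PBond (F.P (i + 1)) (0 + 1)) =>
        (isChartRep_specialUnitaryGroup (n := Fin 2)).logChart
          (avgFun (expMeanLogSU (n := Fin 2)) (fun b => (isChartRep_specialUnitaryGroup (n := Fin 2)).expChart (A b) * V b) c *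
            (avgFun (expMeanLogSU (n := Fin 2)) V c)⁻¹))
        (fun b => (⟨su2Coord (rev (ζ b)), su2Coord_rev_mem_lie (ζ b)⟩ : (specialUnitaryLogChart (Fin 2)).lie)) c =
      (isChartRep_specialUnitaryGroup (n := Fin 2)).logChart
        (avgFun (expMeanLogSU (n := Fin 2)) (fun ℓ => expPoint (ζ ℓ) * V ℓ : GaugeField (F.P (i + 1)) 0 (SU 2)) c *
          (avgFun (expMeanLogSU (n := Fin 2)) V c)⁻¹) := by
  have hfield : (fun b => (isChartRep_specialUnitaryGroup (n := Fin 2)).expChart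
      ((⟨su2Coord (rev (ζ b)), su2Coord_rev_mem_lie (ζ b)⟩ : (specialUnitaryLogChart (Fin 2)).lie)) * V b : GaugeField (F.P (i + 1)) 0 (SU 2)) =
      fun ℓ => expPoint (ζ ℓ) * V ℓ := (piExpPoint_translate_eq V ζ).symm
  simp only [hfield]

/-- ★★ **THE VALUE DICTIONARY AT GAP ONE**: on the log-chart window at `b`, `coord (Mq^{one}(V) ζ b) = sinc‖y₁‖ • y₁` with `y₁ := ψ_V(coord∘ζ)(σ₁ b)` the ONE-STEP log-chart read of (β).
[cite: Balaban1985UV3, p. 260; Balaban1987RG1, (0.4), (0.11) p.253 (bookkeeping)] -/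
theorem coord_qRead_one_apply (i : ℕ) (V : GaugeField (F.P (i + 1)) 0 (SU 2)) (ζ : PBond (F.P (i + 1)) 0 → EuclideanSpace ℝ (Fin 3)) (b : PBond (F.P i) 0)
    (hwin : ‖((avgFun (expMeanLogSU (n := Fin 2)) (fun ℓ => expPoint (ζ ℓ) * V ℓ : GaugeField (F.P (i + 1)) 0 (SU 2))
          (bondShift (F.sitesPerDir_eq (m := F.m) (K := i) (j := 0) (m' := F.m) (K' := i + 1) (j' := 1) (by omega)) b) *
        (avgFun (expMeanLogSU (n := Fin 2)) V
          (bondShift (F.sitesPerDir_eq (m := F.m) (K := i) (j := 0) (m' := F.m) (K' := i + 1) (j' := 1) (by omega)) b))⁻¹ : SU 2) :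
          Matrix (Fin 2) (Fin 2) ℂ) - 1‖ < innerRadius (specialUnitaryLogChart (Fin 2))) :
    (⟨su2Coord (rev (imVec (su2Quat (descendTo F ℰp i (i + 1) (Nat.le_succ i) (fun ℓ => expPoint (ζ ℓ) * V ℓ) b *
        (descendTo F ℰp i (i + 1) (Nat.le_succ i) V b)⁻¹)))), su2Coord_rev_mem_lie _⟩ : (specialUnitaryLogChart (Fin 2)).lie) =
      Real.sinc ‖(fun (A : PBond (F.P (i + 1)) 0 → (specialUnitaryLogChart (Fin 2)).lie) (c : PBond (F.P (i + 1)) (0 + 1)) =>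
            (isChartRep_specialUnitaryGroup (n := Fin 2)).logChart
              (avgFun (expMeanLogSU (n := Fin 2)) (fun b => (isChartRep_specialUnitaryGroup (n := Fin 2)).expChart (A b) * V b) c *
                (avgFun (expMeanLogSU (n := Fin 2)) V c)⁻¹))
            (fun b => (⟨su2Coord (rev (ζ b)), su2Coord_rev_mem_lie (ζ b)⟩ : (specialUnitaryLogChart (Fin 2)).lie))
            (bondShift (F.sitesPerDir_eq (m := F.m) (K := i) (j := 0) (m' := F.m) (K' := i + 1) (j' := 1) (by omega)) b)‖ •
        (fun (A : PBond (F.P (i + 1)) 0 → (specialUnitaryLogChart (Fin 2)).lie) (c : PBond (F.P (i + 1)) (0 + 1)) =>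
            (isChartRep_specialUnitaryGroup (n := Fin 2)).logChart
              (avgFun (expMeanLogSU (n := Fin 2)) (fun b => (isChartRep_specialUnitaryGroup (n := Fin 2)).expChart (A b) * V b) c *
                (avgFun (expMeanLogSU (n := Fin 2)) V c)⁻¹))
            (fun b => (⟨su2Coord (rev (ζ b)), su2Coord_rev_mem_lie (ζ b)⟩ : (specialUnitaryLogChart (Fin 2)).lie))
            (bondShift (F.sitesPerDir_eq (m := F.m) (K := i) (j := 0) (m' := F.m) (K' := i + 1) (j' := 1) (by omega)) b) := by
  have hwin' : ‖((descendTo F ℰp i (i + 1) (Nat.le_succ i) (fun ℓ => expPoint (ζ ℓ) * V ℓ) b *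
      (descendTo F ℰp i (i + 1) (Nat.le_succ i) V b)⁻¹ : SU 2) : Matrix (Fin 2) (Fin 2) ℂ) - 1‖ < innerRadius (specialUnitaryLogChart (Fin 2)) := by
    rw [descendTo_succ_apply, descendTo_succ_apply]; exact hwin
  have h := coord_qRead_apply (F := F) (Nat.le_succ i) V ζ b hwin'
  rw [descendTo_succ_apply, descendTo_succ_apply] at h
  rw [chartRead_avgFun_coord_apply, descendTo_succ_apply, descendTo_succ_apply]
  exact h

end Value

/-! ## §2 The derivative dictionary at gap one -/

section Deriv

/-- **THE ITERATE `Ψ_{i+1−i}` IS THE ONE-STEP CHART READ `ψ_V` READ THROUGH A TRIVIAL REINDEXING** (as functions; §0).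
[cite: Balaban1987RG1, (0.1) p.251, (0.11) p.253 (bookkeeping)] -/
theorem chartRead_iter_sub_self_succ_eq (i : ℕ) (V : GaugeField (F.P (i + 1)) 0 (SU 2)) :
    (fun (A : PBond (F.P (i + 1)) 0 → (specialUnitaryLogChart (Fin 2)).lie) (c : PBond (F.P (i + 1)) (i + 1 - i)) =>
        (isChartRep_specialUnitaryGroup (n := Fin 2)).logChart
          (Averaging.iter (fun j => blockAvg (P := F.P (i + 1)) (j := j) (expMeanLogSU (n := Fin 2))) (i + 1 - i)
              (fun b => (isChartRep_specialUnitaryGroup (n := Fin 2)).expChart (A b) * V b) c *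
            (Averaging.iter (fun j => blockAvg (P := F.P (i + 1)) (j := j) (expMeanLogSU (n := Fin 2))) (i + 1 - i) V c)⁻¹)) =
      (ContinuousLinearMap.pi fun c : PBond (F.P (i + 1)) (i + 1 - i) =>
          ContinuousLinearMap.proj (R := ℝ) (φ := fun _ : PBond (F.P (i + 1)) (0 + 1) => (specialUnitaryLogChart (Fin 2)).lie)
            (bondShift (F.sitesPerDir_eq (m := F.m) (K := i + 1) (j := i + 1 - i) (m' := F.m) (K' := i + 1) (j' := 1) (by omega)) c)) ∘
        (fun (A : PBond (F.P (i + 1)) 0 → (specialUnitaryLogChart (Fin 2)).lie) (c : PBond (F.P (i + 1)) (0 + 1)) =>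
          (isChartRep_specialUnitaryGroup (n := Fin 2)).logChart
            (avgFun (expMeanLogSU (n := Fin 2)) (fun b => (isChartRep_specialUnitaryGroup (n := Fin 2)).expChart (A b) * V b) c *
              (avgFun (expMeanLogSU (n := Fin 2)) V c)⁻¹)) := by
  funext A c
  simp only [Function.comp_apply, ContinuousLinearMap.pi_apply, ContinuousLinearMap.proj_apply]
  rw [iter_sub_self_succ_apply, iter_sub_self_succ_apply]

/-- ★★ **THE DERIVATIVE DICTIONARY AT GAP ONE**: under Q1's guard at `(i, i+1)` (`V ∈ histGood θ (i+1) i`, `0 ≤ θ`, `(5L)²∕4·θ_{i+1} ≤ α ≤ 1∕24`, `α < δ_{SU(2)}`, `157α < L⁻²`),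
`coord ((DMq^{one}(V) η) b) = (fderiv ℝ ψ_V 0 (coord∘η)) (σ₁ b)` — ✓p825180's one-step derivative on a direction IS (β)'s one-step chart-read derivative on its coordinates, read at `σ₁ b`.
[cite: Balaban1985Averaging, Prop. 3 (122)-(124) p.36; Balaban1987RG1, (0.4), (0.11) p.253; Balaban1985UV3, p. 260] -/
theorem coord_qfderiv_one_apply (i : ℕ) {θ : ℕ → ℝ} (hθ0 : ∀ i', 0 ≤ θ i') {α : ℝ}
    (hθα : ∀ i', i < i' → i' ≤ i + 1 → (((5 * F.L : ℕ) : ℝ) ^ 2 / 4) * θ i' ≤ α)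
    (hα24 : α ≤ 1 / 24) (hαδ : α < deltaSU (Fin 2)) (hαL : 157 * α < ((F.L : ℝ) ^ 2)⁻¹)
    {V : GaugeField (F.P (i + 1)) 0 (SU 2)} (hVg : V ∈ histGood F ℰp θ (i + 1) i)
    (η : PBond (F.P (i + 1)) 0 → EuclideanSpace ℝ (Fin 3)) (b : PBond (F.P i) 0) :
    (⟨su2Coord (rev (fderiv ℝ (fun (ζ : PBond (F.P (i + 1)) 0 → EuclideanSpace ℝ (Fin 3)) (B : PBond (F.P i) 0) =>
        imVec (su2Quat (descendTo F ℰp i (i + 1) (Nat.le_succ i) (fun ℓ => expPoint (ζ ℓ) * V ℓ) B *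
          (descendTo F ℰp i (i + 1) (Nat.le_succ i) V B)⁻¹))) 0 η b)), su2Coord_rev_mem_lie _⟩ : (specialUnitaryLogChart (Fin 2)).lie) =
      fderiv ℝ (fun (A : PBond (F.P (i + 1)) 0 → (specialUnitaryLogChart (Fin 2)).lie) (c : PBond (F.P (i + 1)) (0 + 1)) =>
          (isChartRep_specialUnitaryGroup (n := Fin 2)).logChart
            (avgFun (expMeanLogSU (n := Fin 2)) (fun b => (isChartRep_specialUnitaryGroup (n := Fin 2)).expChart (A b) * V b) c *
              (avgFun (expMeanLogSU (n := Fin 2)) V c)⁻¹)) 0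
        (fun ℓ => (⟨su2Coord (rev (η ℓ)), su2Coord_rev_mem_lie (η ℓ)⟩ : (specialUnitaryLogChart (Fin 2)).lie))
        (bondShift (F.sitesPerDir_eq (m := F.m) (K := i) (j := 0) (m' := F.m) (K' := i + 1) (j' := 1) (by omega)) b) := by
  -- Q3 at `(i, i+1)`: the iterate form
  rw [coord_qfderiv_apply (F := F) (Nat.le_succ i) hθ0 hθα hα24 hαδ hαL hVg η b, chartRead_iter_sub_self_succ_eq]
  -- the one-step chart read is smooth at `0` (loop guard of the good history at its own level)
  set ψ := fun (A : PBond (F.P (i + 1)) 0 → (specialUnitaryLogChart (Fin 2)).lie) (c : PBond (F.P (i + 1)) (0 + 1)) =>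
      (isChartRep_specialUnitaryGroup (n := Fin 2)).logChart
        (avgFun (expMeanLogSU (n := Fin 2)) (fun b => (isChartRep_specialUnitaryGroup (n := Fin 2)).expChart (A b) * V b) c *
          (avgFun (expMeanLogSU (n := Fin 2)) V c)⁻¹) with hψ
  set Lτ := (ContinuousLinearMap.pi fun c : PBond (F.P (i + 1)) (i + 1 - i) =>
      ContinuousLinearMap.proj (R := ℝ) (φ := fun _ : PBond (F.P (i + 1)) (0 + 1) => (specialUnitaryLogChart (Fin 2)).lie)
        (bondShift (F.sitesPerDir_eq (m := F.m) (K := i + 1) (j := i + 1 - i) (m' := F.m) (K' := i + 1) (j' := 1) (by omega)) c)) with hLτ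
  have hguard := loopGuard_of_histGood (F := F) hθ0 hθα hVg 0 (by omega)
  have hsmall : ∀ c : PBond (F.P (i + 1)) (0 + 1), Small (expMeanLogSU (n := Fin 2)) V c :=
    fun c idx => lt_of_le_of_lt (hguard c idx) hαδ
  have hdiff : DifferentiableAt ℝ ψ 0 := (contDiffAt_chartRead_avgFun V hsmall).differentiableAt (by simp)
  have hL : HasFDerivAt (⇑Lτ) Lτ (ψ 0) := Lτ.hasFDerivAt
  have hcomp := HasFDerivAt.comp (𝕜 := ℝ) (0 : PBond (F.P (i + 1)) 0 → (specialUnitaryLogChart (Fin 2)).lie) (f := ψ) (f' := fderiv ℝ ψ 0)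
    (g := ⇑Lτ) (g' := Lτ) hL hdiff.hasFDerivAt
  rw [hcomp.fderiv, ContinuousLinearMap.comp_apply, ContinuousLinearMap.pi_apply, ContinuousLinearMap.proj_apply, bondShift_bondShift]

end Deriv

/-! ## §3 The exact gap-one split and its norm form in (β)'s currency -/

section Split

/-- ★★★ **THE EXACT GAP-ONE SPLIT IN (β)'s CURRENCY** (Q1's guard at `(i,i+1)`; the window at `b`): with `X := coord∘ζ̃`, `y₁ := ψ_V(X)(σ₁ b)`,
`coord (Mq^{one} ζ̃ b − DMq^{one}(sinc∘ζ̃•ζ̃) b) = (y₁ − Dψ_V(0) X (σ₁b)) + ((sinc‖y₁‖ − 1)•y₁ − Dψ_V(0) ((sinc∘ζ̃ − 1)•X) (σ₁b))`.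
[cite: Balaban1985Averaging, Prop. 3 (121)-(123) p.36; Balaban1987RG1, (0.4), (0.11) p.253; Balaban1985UV3, p. 260] -/
theorem coord_qRead_one_sub_qfderiv_sinc_eq (i : ℕ) {θ : ℕ → ℝ} (hθ0 : ∀ i', 0 ≤ θ i') {α : ℝ}
    (hθα : ∀ i', i < i' → i' ≤ i + 1 → (((5 * F.L : ℕ) : ℝ) ^ 2 / 4) * θ i' ≤ α)
    (hα24 : α ≤ 1 / 24) (hαδ : α < deltaSU (Fin 2)) (hαL : 157 * α < ((F.L : ℝ) ^ 2)⁻¹)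
    {V : GaugeField (F.P (i + 1)) 0 (SU 2)} (hVg : V ∈ histGood F ℰp θ (i + 1) i)
    (ζ : PBond (F.P (i + 1)) 0 → EuclideanSpace ℝ (Fin 3)) (b : PBond (F.P i) 0)
    (hwin : ‖((avgFun (expMeanLogSU (n := Fin 2)) (fun ℓ => expPoint (ζ ℓ) * V ℓ : GaugeField (F.P (i + 1)) 0 (SU 2))
          (bondShift (F.sitesPerDir_eq (m := F.m) (K := i) (j := 0) (m' := F.m) (K' := i + 1) (j' := 1) (by omega)) b) *
        (avgFun (expMeanLogSU (n := Fin 2)) V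
          (bondShift (F.sitesPerDir_eq (m := F.m) (K := i) (j := 0) (m' := F.m) (K' := i + 1) (j' := 1) (by omega)) b))⁻¹ : SU 2) :
          Matrix (Fin 2) (Fin 2) ℂ) - 1‖ < innerRadius (specialUnitaryLogChart (Fin 2))) :
    (⟨su2Coord (rev (imVec (su2Quat (descendTo F ℰp i (i + 1) (Nat.le_succ i) (fun ℓ => expPoint (ζ ℓ) * V ℓ) b *
          (descendTo F ℰp i (i + 1) (Nat.le_succ i) V b)⁻¹)) -
        fderiv ℝ (fun (ζ : PBond (F.P (i + 1)) 0 → EuclideanSpace ℝ (Fin 3)) (B : PBond (F.P i) 0) =>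
          imVec (su2Quat (descendTo F ℰp i (i + 1) (Nat.le_succ i) (fun ℓ => expPoint (ζ ℓ) * V ℓ) B *
            (descendTo F ℰp i (i + 1) (Nat.le_succ i) V B)⁻¹))) 0 (fun ℓ => Real.sinc ‖ζ ℓ‖ • ζ ℓ) b)),
        su2Coord_rev_mem_lie _⟩ : (specialUnitaryLogChart (Fin 2)).lie) =
      ((fun (A : PBond (F.P (i + 1)) 0 → (specialUnitaryLogChart (Fin 2)).lie) (c : PBond (F.P (i + 1)) (0 + 1)) =>
            (isChartRep_specialUnitaryGroup (n := Fin 2)).logChart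
              (avgFun (expMeanLogSU (n := Fin 2)) (fun b => (isChartRep_specialUnitaryGroup (n := Fin 2)).expChart (A b) * V b) c *
                (avgFun (expMeanLogSU (n := Fin 2)) V c)⁻¹))
            (fun ℓ => (⟨su2Coord (rev (ζ ℓ)), su2Coord_rev_mem_lie (ζ ℓ)⟩ : (specialUnitaryLogChart (Fin 2)).lie))
            (bondShift (F.sitesPerDir_eq (m := F.m) (K := i) (j := 0) (m' := F.m) (K' := i + 1) (j' := 1) (by omega)) b) -
          fderiv ℝ (fun (A : PBond (F.P (i + 1)) 0 → (specialUnitaryLogChart (Fin 2)).lie) (c : PBond (F.P (i + 1)) (0 + 1)) =>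
              (isChartRep_specialUnitaryGroup (n := Fin 2)).logChart
                (avgFun (expMeanLogSU (n := Fin 2)) (fun b => (isChartRep_specialUnitaryGroup (n := Fin 2)).expChart (A b) * V b) c *
                  (avgFun (expMeanLogSU (n := Fin 2)) V c)⁻¹)) 0
            (fun ℓ => (⟨su2Coord (rev (ζ ℓ)), su2Coord_rev_mem_lie (ζ ℓ)⟩ : (specialUnitaryLogChart (Fin 2)).lie))
            (bondShift (F.sitesPerDir_eq (m := F.m) (K := i) (j := 0) (m' := F.m) (K' := i + 1) (j' := 1) (by omega)) b)) +
        ((Real.sinc ‖(fun (A : PBond (F.P (i + 1)) 0 → (specialUnitaryLogChart (Fin 2)).lie) (c : PBond (F.P (i + 1)) (0 + 1)) =>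
              (isChartRep_specialUnitaryGroup (n := Fin 2)).logChart
                (avgFun (expMeanLogSU (n := Fin 2)) (fun b => (isChartRep_specialUnitaryGroup (n := Fin 2)).expChart (A b) * V b) c *
                  (avgFun (expMeanLogSU (n := Fin 2)) V c)⁻¹))
              (fun ℓ => (⟨su2Coord (rev (ζ ℓ)), su2Coord_rev_mem_lie (ζ ℓ)⟩ : (specialUnitaryLogChart (Fin 2)).lie))
              (bondShift (F.sitesPerDir_eq (m := F.m) (K := i) (j := 0) (m' := F.m) (K' := i + 1) (j' := 1) (by omega)) b)‖ - 1) •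
            (fun (A : PBond (F.P (i + 1)) 0 → (specialUnitaryLogChart (Fin 2)).lie) (c : PBond (F.P (i + 1)) (0 + 1)) =>
              (isChartRep_specialUnitaryGroup (n := Fin 2)).logChart
                (avgFun (expMeanLogSU (n := Fin 2)) (fun b => (isChartRep_specialUnitaryGroup (n := Fin 2)).expChart (A b) * V b) c *
                  (avgFun (expMeanLogSU (n := Fin 2)) V c)⁻¹))
              (fun ℓ => (⟨su2Coord (rev (ζ ℓ)), su2Coord_rev_mem_lie (ζ ℓ)⟩ : (specialUnitaryLogChart (Fin 2)).lie))
              (bondShift (F.sitesPerDir_eq (m := F.m) (K := i) (j := 0) (m' := F.m) (K' := i + 1) (j' := 1) (by omega)) b) -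
          fderiv ℝ (fun (A : PBond (F.P (i + 1)) 0 → (specialUnitaryLogChart (Fin 2)).lie) (c : PBond (F.P (i + 1)) (0 + 1)) =>
              (isChartRep_specialUnitaryGroup (n := Fin 2)).logChart
                (avgFun (expMeanLogSU (n := Fin 2)) (fun b => (isChartRep_specialUnitaryGroup (n := Fin 2)).expChart (A b) * V b) c *
                  (avgFun (expMeanLogSU (n := Fin 2)) V c)⁻¹)) 0
            (fun ℓ => (Real.sinc ‖ζ ℓ‖ - 1) • (⟨su2Coord (rev (ζ ℓ)), su2Coord_rev_mem_lie (ζ ℓ)⟩ : (specialUnitaryLogChart (Fin 2)).lie))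
            (bondShift (F.sitesPerDir_eq (m := F.m) (K := i) (j := 0) (m' := F.m) (K' := i + 1) (j' := 1) (by omega)) b)) := by
  set ψ := fun (A : PBond (F.P (i + 1)) 0 → (specialUnitaryLogChart (Fin 2)).lie) (c : PBond (F.P (i + 1)) (0 + 1)) =>
      (isChartRep_specialUnitaryGroup (n := Fin 2)).logChart
        (avgFun (expMeanLogSU (n := Fin 2)) (fun b => (isChartRep_specialUnitaryGroup (n := Fin 2)).expChart (A b) * V b) c *
          (avgFun (expMeanLogSU (n := Fin 2)) V c)⁻¹) with hψ
  set X := fun ℓ : PBond (F.P (i + 1)) 0 => (⟨su2Coord (rev (ζ ℓ)), su2Coord_rev_mem_lie (ζ ℓ)⟩ : (specialUnitaryLogChart (Fin 2)).lie) with hX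
  -- derivative half on the sinc-fed field, split by linearity
  have hD := coord_qfderiv_one_apply (F := F) i hθ0 hθα hα24 hαδ hαL hVg (fun ℓ => Real.sinc ‖ζ ℓ‖ • ζ ℓ) b
  have hcoordη : (fun ℓ : PBond (F.P (i + 1)) 0 => (⟨su2Coord (rev ((fun ℓ => Real.sinc ‖ζ ℓ‖ • ζ ℓ) ℓ)), su2Coord_rev_mem_lie _⟩ :
      (specialUnitaryLogChart (Fin 2)).lie)) = X + fun ℓ => (Real.sinc ‖ζ ℓ‖ - 1) • X ℓ := by
    funext ℓ
    simp only [hX, Pi.add_apply]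
    rw [coord_smul, sub_smul, one_smul, add_sub_cancel]
  rw [hcoordη, map_add, Pi.add_apply] at hD
  -- value half
  have hV := coord_qRead_one_apply (F := F) i V ζ b hwin
  rw [coord_sub, hV, hD]
  simp only [sub_smul, one_smul]
  abel

/-- ★★★ **THE NORM FORM AT GAP ONE** (first term in (β-3)'s matrix-coercion currency): with `X := coord∘ζ̃`, `y₁ := ψ_V(X)(σ₁ b)`,
`‖Mq^{one} ζ̃ b − DMq^{one}(sinc∘ζ̃•ζ̃) b‖ ≤ ‖↑y₁ − ↑(Dψ_V(0) X (σ₁b))‖ + ‖y₁‖³∕6 + ‖Dψ_V(0)((sinc∘ζ̃ − 1)•X)(σ₁b)‖` — the first term is the left side of (β-3)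
✓`norm_chartRead_sub_fderiv_le_SU2` ∕ `_local` at `(V, X, σ₁ b)`. [cite: Balaban1985Averaging, Prop. 3 (123) p.36; Balaban1987RG1, (0.4), (0.11) p.253; Balaban1985UV3, p. 260] -/
theorem norm_qRead_one_sub_qfderiv_sinc_le (i : ℕ) {θ : ℕ → ℝ} (hθ0 : ∀ i', 0 ≤ θ i') {α : ℝ}
    (hθα : ∀ i', i < i' → i' ≤ i + 1 → (((5 * F.L : ℕ) : ℝ) ^ 2 / 4) * θ i' ≤ α)
    (hα24 : α ≤ 1 / 24) (hαδ : α < deltaSU (Fin 2)) (hαL : 157 * α < ((F.L : ℝ) ^ 2)⁻¹)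
    {V : GaugeField (F.P (i + 1)) 0 (SU 2)} (hVg : V ∈ histGood F ℰp θ (i + 1) i)
    (ζ : PBond (F.P (i + 1)) 0 → EuclideanSpace ℝ (Fin 3)) (b : PBond (F.P i) 0)
    (hwin : ‖((avgFun (expMeanLogSU (n := Fin 2)) (fun ℓ => expPoint (ζ ℓ) * V ℓ : GaugeField (F.P (i + 1)) 0 (SU 2))
          (bondShift (F.sitesPerDir_eq (m := F.m) (K := i) (j := 0) (m' := F.m) (K' := i + 1) (j' := 1) (by omega)) b) *
        (avgFun (expMeanLogSU (n := Fin 2)) V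
          (bondShift (F.sitesPerDir_eq (m := F.m) (K := i) (j := 0) (m' := F.m) (K' := i + 1) (j' := 1) (by omega)) b))⁻¹ : SU 2) :
          Matrix (Fin 2) (Fin 2) ℂ) - 1‖ < innerRadius (specialUnitaryLogChart (Fin 2))) :
    ‖imVec (su2Quat (descendTo F ℰp i (i + 1) (Nat.le_succ i) (fun ℓ => expPoint (ζ ℓ) * V ℓ) b *
          (descendTo F ℰp i (i + 1) (Nat.le_succ i) V b)⁻¹)) -
        fderiv ℝ (fun (ζ : PBond (F.P (i + 1)) 0 → EuclideanSpace ℝ (Fin 3)) (B : PBond (F.P i) 0) =>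
          imVec (su2Quat (descendTo F ℰp i (i + 1) (Nat.le_succ i) (fun ℓ => expPoint (ζ ℓ) * V ℓ) B *
            (descendTo F ℰp i (i + 1) (Nat.le_succ i) V B)⁻¹))) 0 (fun ℓ => Real.sinc ‖ζ ℓ‖ • ζ ℓ) b‖ ≤
      ‖(((fun (A : PBond (F.P (i + 1)) 0 → (specialUnitaryLogChart (Fin 2)).lie) (c : PBond (F.P (i + 1)) (0 + 1)) =>
            (isChartRep_specialUnitaryGroup (n := Fin 2)).logChart
              (avgFun (expMeanLogSU (n := Fin 2)) (fun b => (isChartRep_specialUnitaryGroup (n := Fin 2)).expChart (A b) * V b) c *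
                (avgFun (expMeanLogSU (n := Fin 2)) V c)⁻¹))
            (fun ℓ => (⟨su2Coord (rev (ζ ℓ)), su2Coord_rev_mem_lie (ζ ℓ)⟩ : (specialUnitaryLogChart (Fin 2)).lie))
            (bondShift (F.sitesPerDir_eq (m := F.m) (K := i) (j := 0) (m' := F.m) (K' := i + 1) (j' := 1) (by omega)) b) :
            (specialUnitaryLogChart (Fin 2)).lie) : Matrix (Fin 2) (Fin 2) ℂ) -
        ((fderiv ℝ (fun (A : PBond (F.P (i + 1)) 0 → (specialUnitaryLogChart (Fin 2)).lie) (c : PBond (F.P (i + 1)) (0 + 1)) =>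
              (isChartRep_specialUnitaryGroup (n := Fin 2)).logChart
                (avgFun (expMeanLogSU (n := Fin 2)) (fun b => (isChartRep_specialUnitaryGroup (n := Fin 2)).expChart (A b) * V b) c *
                  (avgFun (expMeanLogSU (n := Fin 2)) V c)⁻¹)) 0
            (fun ℓ => (⟨su2Coord (rev (ζ ℓ)), su2Coord_rev_mem_lie (ζ ℓ)⟩ : (specialUnitaryLogChart (Fin 2)).lie))
            (bondShift (F.sitesPerDir_eq (m := F.m) (K := i) (j := 0) (m' := F.m) (K' := i + 1) (j' := 1) (by omega)) b) :
            (specialUnitaryLogChart (Fin 2)).lie) : Matrix (Fin 2) (Fin 2) ℂ)‖ +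
      ‖(fun (A : PBond (F.P (i + 1)) 0 → (specialUnitaryLogChart (Fin 2)).lie) (c : PBond (F.P (i + 1)) (0 + 1)) =>
            (isChartRep_specialUnitaryGroup (n := Fin 2)).logChart
              (avgFun (expMeanLogSU (n := Fin 2)) (fun b => (isChartRep_specialUnitaryGroup (n := Fin 2)).expChart (A b) * V b) c *
                (avgFun (expMeanLogSU (n := Fin 2)) V c)⁻¹))
            (fun ℓ => (⟨su2Coord (rev (ζ ℓ)), su2Coord_rev_mem_lie (ζ ℓ)⟩ : (specialUnitaryLogChart (Fin 2)).lie))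
            (bondShift (F.sitesPerDir_eq (m := F.m) (K := i) (j := 0) (m' := F.m) (K' := i + 1) (j' := 1) (by omega)) b)‖ ^ 3 / 6 +
      ‖fderiv ℝ (fun (A : PBond (F.P (i + 1)) 0 → (specialUnitaryLogChart (Fin 2)).lie) (c : PBond (F.P (i + 1)) (0 + 1)) =>
              (isChartRep_specialUnitaryGroup (n := Fin 2)).logChart
                (avgFun (expMeanLogSU (n := Fin 2)) (fun b => (isChartRep_specialUnitaryGroup (n := Fin 2)).expChart (A b) * V b) c *
                  (avgFun (expMeanLogSU (n := Fin 2)) V c)⁻¹)) 0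
            (fun ℓ => (Real.sinc ‖ζ ℓ‖ - 1) • (⟨su2Coord (rev (ζ ℓ)), su2Coord_rev_mem_lie (ζ ℓ)⟩ : (specialUnitaryLogChart (Fin 2)).lie))
            (bondShift (F.sitesPerDir_eq (m := F.m) (K := i) (j := 0) (m' := F.m) (K' := i + 1) (j' := 1) (by omega)) b)‖ := by
  have key := congrArg (fun z : (specialUnitaryLogChart (Fin 2)).lie => ‖z‖)
    (coord_qRead_one_sub_qfderiv_sinc_eq (F := F) i hθ0 hθα hα24 hαδ hαL hVg ζ b hwin)
  simp only [norm_coord_eq] at key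
  rw [key]
  set y := (fun (A : PBond (F.P (i + 1)) 0 → (specialUnitaryLogChart (Fin 2)).lie) (c : PBond (F.P (i + 1)) (0 + 1)) =>
            (isChartRep_specialUnitaryGroup (n := Fin 2)).logChart
              (avgFun (expMeanLogSU (n := Fin 2)) (fun b => (isChartRep_specialUnitaryGroup (n := Fin 2)).expChart (A b) * V b) c *
                (avgFun (expMeanLogSU (n := Fin 2)) V c)⁻¹))
            (fun ℓ => (⟨su2Coord (rev (ζ ℓ)), su2Coord_rev_mem_lie (ζ ℓ)⟩ : (specialUnitaryLogChart (Fin 2)).lie))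
            (bondShift (F.sitesPerDir_eq (m := F.m) (K := i) (j := 0) (m' := F.m) (K' := i + 1) (j' := 1) (by omega)) b) with hy
  have hb : ‖(Real.sinc ‖y‖ - 1) • y‖ ≤ ‖y‖ ^ 3 / 6 := by
    rw [sub_smul, one_smul]; exact norm_sinc_smul_sub_self_le y
  have hcoe : ∀ z z' : (specialUnitaryLogChart (Fin 2)).lie, ‖z - z'‖ = ‖((z : Matrix (Fin 2) (Fin 2) ℂ)) - (z' : Matrix (Fin 2) (Fin 2) ℂ)‖ := fun z z' => by
    rw [Submodule.coe_norm, Submodule.coe_sub]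
  rw [← hcoe]
  exact (norm_add_le_of_le le_rfl (norm_sub_le_of_le hb le_rfl)).trans (le_of_eq (add_assoc _ _ _).symm)

end Split

end Summit.QuantumFields.YangMills.Theorems.FluctuationComparisonRegPrIntLS2BetaQuaternionReadOneStepDictionary

end
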